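import Literature.Analysis.FluidPDE.StokesTorusFrameBound
import Literature.Analysis.FluidPDE.StokesTorusBilinearCoefficients
import Literature.Analysis.FluidPDE.StokesTorusSelfAdjointProofs
import Literature.Analysis.FluidPDE.EnergySpaceTorusHilbertBasisProofs
import HarnessLib

/-!
# The bounded bilinear form of the mild Navier–Stokes formulation on the energy space of `T³`

Analysis/FluidPDE support file (everything proved; no definitions, no named facts), second half of
the construction whose coefficient estimates are in `StokesTorusBilinearCoefficients.lean`.  Let
`H = Torus.energySpace d` (`card d = 3`) with a Hilbert basis `b` of Stokes modes
(`b i = stokesModeL2 kᵢ aᵢ cᵢ`, eigenvalues `m i = 4π²|kᵢ|²` of the Stokes operator `A`), and let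
`S : H →L[ℝ] H` be the frame operator `(1 + A)^{-1/2}`, `S (b i) = (1 + m i)^{-1/2} b i`.  The
Fujita–Kato / Constantin–Foias estimate `|b(u, v, w)| ≤ C ‖A^{1/2} u‖ ‖A^{1/2} v‖ ‖A^{1/4} w‖`
(Constantin–Foias 1988, Ch. 6, (6.9)–(6.10) with `s₁ = s₂ = 1`, `s₃ = 1/2`) says that
`N(y, z) := A^{-3/4} (1 + A)^{1/2} P B(S y, S z)` is a BOUNDED bilinear map `H × H → H`.  We construct
it in mode coordinates (`Torus.exists_mildBilinearForm`): there is `N : H →L[ℝ] H →L[ℝ] H` with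

  `⟪N y z, b i⟫ = -(mᵢ^{-3/4} (1 + mᵢ)^{1/2}) ∫ ⟪S z, ((S y)·∇) φᵢ⟫`

for every mode `φᵢ = stokesMode k a c` representing `b i` — the coefficient
`mᵢ^{-3/4}(1+mᵢ)^{1/2} ⟪B(S y, S z), φᵢ⟫` after the antisymmetry `⟪B(u, w), φ⟫ = -∫ ⟪w, (u·∇)φ⟫`,
written with the `L²` representatives only (no derivative of `S y`, `S z` is taken).

## Construction

With `u = S y`, `w = S z` (as functions) and `γₖ = λₖ^{-3/4}(1 + λₖ)^{1/2}`, `λₖ = 4π²|k|²`, set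
`G(k) := -γₖ · (-2πi) · 𝓕(⟪k, u⟫ w)(k) ∈ ℂ^d`.  Then

* `∫ ⟪w, (u·∇)(stokesMode k a c)⟫ = Re ⟪ζ, (-2πi) 𝓕(⟪k, u⟫ w)(k)⟫_ℂ`
  (`Torus.integral_inner_convect_stokesMode`), so `Re ⟪ζ, G(k)⟫ = -γₖ ∫ ⟪w, (u·∇)φ⟫`;
* `G` is conjugate symmetric and `∑ₖ ‖G(k)‖² ≤ C ‖y‖² ‖z‖²`: `‖G(k)‖² ≤ 4πd ⟨k⟩ (∑ⱼ ‖ŵ(k-j)‖ ‖û(j)‖)²`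
  (`Torus.enorm_sq_mFourierCoeff_inner_smul_le` and `(2π)² γₖ² d |k|² ≤ 4πd ⟨k⟩`), the lattice
  product law `H¹ · H¹ ⊂ H^{1/2}` (`Lattice.tsum_weight_mul_conv_sq_le`, `card d = 3`) and the frame
  bound `∑ⱼ ⟨j⟩² ‖𝓕(S y)(j)‖² ≤ ‖y‖²` (`Torus.tsum_one_add_freqNormSq_mul_enorm_sq_le`);
* Riesz–Fischer (`Torus.exists_forall_mFourierCoeff_eq_of_isConjSymm`) gives `v(y, z) ∈ L²` with
  `v̂ = G`, `‖v‖ ≤ √C ‖y‖ ‖z‖`, bilinear in `(y, z)` by uniqueness of Fourier coefficients;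
  `N y z := P v(y, z)` (orthogonal projection onto `H`), packaged by `LinearMap.mkContinuous₂`, and
  `⟪N y z, b i⟫ = ⟪v, b i⟫ = Re ⟪ζᵢ, G(kᵢ)⟫` (`Torus.inner_stokesModeL2_coe`).

## References

* P. Constantin, C. Foias, *Navier–Stokes Equations*, Univ. Chicago Press (1988), Ch. 6,
  (6.9)–(6.10), (6.19). [ConstantinFoiasNSE1988]
* H. Fujita, T. Kato, On the Navier–Stokes initial value problem. I, Arch. Rational Mech. Anal. 16
  (1964) 269–315, Lemma 1.3–1.4. [FujitaKato1964ARMA]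
-/

noncomputable section

open MeasureTheory Filter UnitAddTorus
open scoped InnerProductSpace RealInnerProductSpace ENNReal Topology ComplexConjugate

namespace Literature.Analysis.FluidPDE

namespace Torus

variable {d : Type*} [Fintype d] [DecidableEq d]

/-! ### The coefficient field `v(y, z)`: existence, bound, bilinearity -/

/-- **Bilinearity of the coefficient field.**  If `v y z ∈ L²` has the Fourier coefficients
`𝓕(v y z)(k) = -γₖ (-2πi) 𝓕(⟪k, S y⟫ S z)(k)` for a continuous linear `S`, then `v` is additive and
homogeneous in each argument (uniqueness of Fourier coefficients and the algebra of
`𝓕(⟪k, u⟫ w)(k)` in `u`, `w`, `Torus.mFourierCoeff_inner_smul_*`). [folklore] -/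
theorem bilinear_of_mFourierCoeff_eq_stokesWeight_smul
    (S : FunctionSpaces.Torus.energySpace d →L[ℝ] FunctionSpaces.Torus.energySpace d)
    (v : FunctionSpaces.Torus.energySpace d → FunctionSpaces.Torus.energySpace d → Lp (EuclideanSpace ℝ d) 2 (volume : Measure (UnitAddTorus d)))
    (hv : ∀ (y z : FunctionSpaces.Torus.energySpace d) (k : d → ℤ),
      mFourierCoeff (FunctionSpaces.EuclideanSpace.complexify ∘ ((v y z : Lp (EuclideanSpace ℝ d) 2 (volume : Measure (UnitAddTorus d))) : UnitAddTorus d → EuclideanSpace ℝ d)) k =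
        ((-(stokesEigenvalue k ^ (-(3 / 4 : ℝ)) * (1 + stokesEigenvalue k) ^ (1 / 2 : ℝ)) : ℝ) : ℂ) •
            ((-(2 * Real.pi * Complex.I)) •
              mFourierCoeff (FunctionSpaces.EuclideanSpace.complexify ∘
                fun x => ⟪FunctionSpaces.Torus.latticeVec k, (((S y : FunctionSpaces.Torus.energySpace d) : Lp (EuclideanSpace ℝ d) 2 (volume : Measure (UnitAddTorus d))) : UnitAddTorus d → EuclideanSpace ℝ d) x⟫_ℝ • (((S z : FunctionSpaces.Torus.energySpace d) : Lp (EuclideanSpace ℝ d) 2 (volume : Measure (UnitAddTorus d))) : UnitAddTorus d → EuclideanSpace ℝ d) x) k)) :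
    (∀ y₁ y₂ z, v (y₁ + y₂) z = v y₁ z + v y₂ z) ∧ (∀ (r : ℝ) y z, v (r • y) z = r • v y z) ∧
      (∀ y z₁ z₂, v y (z₁ + z₂) = v y z₁ + v y z₂) ∧ (∀ (r : ℝ) y z, v y (r • z) = r • v y z) := by
  -- representatives of `S y`
  set T : FunctionSpaces.Torus.energySpace d → UnitAddTorus d → EuclideanSpace ℝ d := fun y =>
    (((S y : FunctionSpaces.Torus.energySpace d) : Lp (EuclideanSpace ℝ d) 2 (volume : Measure (UnitAddTorus d))) : UnitAddTorus d → EuclideanSpace ℝ d) with hT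
  have hT2 : ∀ y, MemLp (T y) 2 volume := fun y => Lp.memLp _
  have hTadd : ∀ y₁ y₂, T (y₁ + y₂) =ᵐ[volume] T y₁ + T y₂ := fun y₁ y₂ => by
    simp only [hT, map_add, Submodule.coe_add]
    exact Lp.coeFn_add _ _
  have hTsmul : ∀ (r : ℝ) y, T (r • y) =ᵐ[volume] r • T y := fun r y => by
    simp only [hT, map_smul, Submodule.coe_smul]
    exact Lp.coeFn_smul _ _
  -- the coefficient family
  obtain ⟨G, hG⟩ : ∃ G : FunctionSpaces.Torus.energySpace d → FunctionSpaces.Torus.energySpace d →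
      (d → ℤ) → EuclideanSpace ℂ d, ∀ y z k, G y z k =
        ((-(stokesEigenvalue k ^ (-(3 / 4 : ℝ)) * (1 + stokesEigenvalue k) ^ (1 / 2 : ℝ)) : ℝ) : ℂ) •
          ((-(2 * Real.pi * Complex.I)) •
            mFourierCoeff (FunctionSpaces.EuclideanSpace.complexify ∘
              fun x => ⟪FunctionSpaces.Torus.latticeVec k, T y x⟫_ℝ • T z x) k) :=
    ⟨fun y z k => _, fun _ _ _ => rfl⟩
  have hv' : ∀ y z k, mFourierCoeff (FunctionSpaces.EuclideanSpace.complexify ∘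
      ((v y z : Lp (EuclideanSpace ℝ d) 2 (volume : Measure (UnitAddTorus d))) : UnitAddTorus d → EuclideanSpace ℝ d)) k = G y z k := fun y z k => by
    rw [hG]; exact hv y z k
  -- algebra of `G`
  have hGaddl : ∀ y₁ y₂ z k, G (y₁ + y₂) z k = G y₁ z k + G y₂ z k := by
    intro y₁ y₂ z k
    rw [hG, hG, hG, mFourierCoeff_inner_smul_congr_ae (hTadd y₁ y₂) EventuallyEq.rfl,
      mFourierCoeff_inner_smul_add_left (hT2 y₁) (hT2 y₂) (hT2 z), smul_add, smul_add]
  have hGaddr : ∀ y z₁ z₂ k, G y (z₁ + z₂) k = G y z₁ k + G y z₂ k := by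
    intro y z₁ z₂ k
    rw [hG, hG, hG, mFourierCoeff_inner_smul_congr_ae EventuallyEq.rfl (hTadd z₁ z₂),
      mFourierCoeff_inner_smul_add_right (hT2 y) (hT2 z₁) (hT2 z₂), smul_add, smul_add]
  have hGsmull : ∀ (r : ℝ) y z k, G (r • y) z k = (r : ℂ) • G y z k := by
    intro r y z k
    rw [hG, hG, mFourierCoeff_inner_smul_congr_ae (hTsmul r y) EventuallyEq.rfl,
      mFourierCoeff_inner_smul_smul_left, smul_comm _ (r : ℂ), smul_comm _ (r : ℂ)]
  have hGsmulr : ∀ (r : ℝ) y z k, G y (r • z) k = (r : ℂ) • G y z k := by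
    intro r y z k
    rw [hG, hG, mFourierCoeff_inner_smul_congr_ae EventuallyEq.rfl (hTsmul r z),
      mFourierCoeff_inner_smul_smul_right, smul_comm _ (r : ℂ), smul_comm _ (r : ℂ)]
  -- bilinearity of `v` by uniqueness of coefficients
  refine ⟨fun y₁ y₂ z => ?_, fun r y z => ?_, fun y z₁ z₂ => ?_, fun r y z => ?_⟩
  · exact Lp_eq_of_forall_mFourierCoeff_eq fun k => by
      simp only [mFourierCoeff_complexify_coe_add, hv']
      exact hGaddl y₁ y₂ z k
  · exact Lp_eq_of_forall_mFourierCoeff_eq fun k => by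
      simp only [mFourierCoeff_complexify_coe_smul, hv']
      exact hGsmull r y z k
  · exact Lp_eq_of_forall_mFourierCoeff_eq fun k => by
      simp only [mFourierCoeff_complexify_coe_add, hv']
      exact hGaddr y z₁ z₂ k
  · exact Lp_eq_of_forall_mFourierCoeff_eq fun k => by
      simp only [mFourierCoeff_complexify_coe_smul, hv']
      exact hGsmulr r y z k

/-- **Existence and bound of the coefficient field.**  On a three-dimensional torus, for a Hilbert
basis of Stokes modes and the frame operator `S` (`S (b i) = (1 + m i)^{-1/2} b i`), for all
`y, z ∈ H` there is `v(y, z) ∈ L²(T^d; ℝ^d)` with Fourier coefficients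
`𝓕(v(y, z))(k) = -γₖ (-2πi) 𝓕(⟪k, S y⟫ S z)(k)` and `‖v(y, z)‖ ≤ C ‖y‖ ‖z‖` (Riesz–Fischer applied to
the conjugate-symmetric family, square summable by
`Torus.tsum_enorm_sq_stokesWeight_smul_mFourierCoeff_le` and the frame bound
`Torus.tsum_one_add_freqNormSq_mul_enorm_sq_le`; Constantin–Foias 1988, Ch. 6, (6.9)–(6.10)).
[cite: ConstantinFoiasNSE1988, Ch. 6 (6.9)–(6.10)] -/
theorem exists_coefficientField (hd : Fintype.card d = 3) {ι : Type*}
    (b : HilbertBasis ι ℝ (FunctionSpaces.Torus.energySpace d)) (m : ι → ℝ)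
    (hb : ∀ i, ∃ (k : d → ℤ) (a : EuclideanSpace ℝ d) (c : Bool),
      ((b i : FunctionSpaces.Torus.energySpace d) : Lp (EuclideanSpace ℝ d) 2 (volume : Measure (UnitAddTorus d))) = stokesModeL2 k a c ∧ m i = stokesEigenvalue k)
    (S : FunctionSpaces.Torus.energySpace d →L[ℝ] FunctionSpaces.Torus.energySpace d)
    (hS : ∀ i, S (b i) = ((1 + m i) ^ (-(1 / 2 : ℝ))) • b i) :
    ∃ (C : ℝ) (v : FunctionSpaces.Torus.energySpace d → FunctionSpaces.Torus.energySpace d → Lp (EuclideanSpace ℝ d) 2 (volume : Measure (UnitAddTorus d))),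
      (∀ y z, ‖v y z‖ ≤ C * ‖y‖ * ‖z‖) ∧
      ∀ (y z : FunctionSpaces.Torus.energySpace d) (k : d → ℤ),
        mFourierCoeff (FunctionSpaces.EuclideanSpace.complexify ∘ ((v y z : Lp (EuclideanSpace ℝ d) 2 (volume : Measure (UnitAddTorus d))) : UnitAddTorus d → EuclideanSpace ℝ d)) k =
          ((-(stokesEigenvalue k ^ (-(3 / 4 : ℝ)) * (1 + stokesEigenvalue k) ^ (1 / 2 : ℝ)) : ℝ) : ℂ) •
            ((-(2 * Real.pi * Complex.I)) •
              mFourierCoeff (FunctionSpaces.EuclideanSpace.complexify ∘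
                fun x => ⟪FunctionSpaces.Torus.latticeVec k, (((S y : FunctionSpaces.Torus.energySpace d) : Lp (EuclideanSpace ℝ d) 2 (volume : Measure (UnitAddTorus d))) : UnitAddTorus d → EuclideanSpace ℝ d) x⟫_ℝ • (((S z : FunctionSpaces.Torus.energySpace d) : Lp (EuclideanSpace ℝ d) 2 (volume : Measure (UnitAddTorus d))) : UnitAddTorus d → EuclideanSpace ℝ d) x) k) := by
  -- representatives of `S y`
  set T : FunctionSpaces.Torus.energySpace d → UnitAddTorus d → EuclideanSpace ℝ d := fun y =>
    (((S y : FunctionSpaces.Torus.energySpace d) : Lp (EuclideanSpace ℝ d) 2 (volume : Measure (UnitAddTorus d))) : UnitAddTorus d → EuclideanSpace ℝ d) with hT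
  have hT2 : ∀ y, MemLp (T y) 2 volume := fun y => Lp.memLp _
  -- the coefficient family
  obtain ⟨G, hG⟩ : ∃ G : FunctionSpaces.Torus.energySpace d → FunctionSpaces.Torus.energySpace d →
      (d → ℤ) → EuclideanSpace ℂ d, ∀ y z k, G y z k =
        ((-(stokesEigenvalue k ^ (-(3 / 4 : ℝ)) * (1 + stokesEigenvalue k) ^ (1 / 2 : ℝ)) : ℝ) : ℂ) •
          ((-(2 * Real.pi * Complex.I)) •
            mFourierCoeff (FunctionSpaces.EuclideanSpace.complexify ∘
              fun x => ⟪FunctionSpaces.Torus.latticeVec k, T y x⟫_ℝ • T z x) k) :=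
    ⟨fun y z k => _, fun _ _ _ => rfl⟩
  have hGsymm : ∀ y z, FunctionSpaces.Torus.IsConjSymm (G y z) := fun y z k => by
    rw [hG, hG]
    exact isConjSymm_stokesWeight_smul_mFourierCoeff (hT2 y) (hT2 z) k
  -- the quantitative square-summability
  obtain ⟨C, hC, hCb⟩ := tsum_enorm_sq_stokesWeight_smul_mFourierCoeff_le (d := d) hd
  have hGle : ∀ y z, ∑' k, ‖G y z k‖ₑ ^ 2 ≤ ENNReal.ofReal (C * ‖z‖ ^ 2 * ‖y‖ ^ 2) := by
    intro y z
    have h1 := hCb (T y) (T z) (hT2 y) (hT2 z)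
    have hy := tsum_one_add_freqNormSq_mul_enorm_sq_le b m hb S hS y
    have hz := tsum_one_add_freqNormSq_mul_enorm_sq_le b m hb S hS z
    simp only [hG]
    refine h1.trans ?_
    calc ENNReal.ofReal C * (_ * _)
        ≤ ENNReal.ofReal C * (ENNReal.ofReal (‖z‖ ^ 2) * ENNReal.ofReal (‖y‖ ^ 2)) :=
          mul_le_mul_right (mul_le_mul hz hy bot_le bot_le) _
      _ = ENNReal.ofReal (C * ‖z‖ ^ 2 * ‖y‖ ^ 2) := by
          rw [← ENNReal.ofReal_mul (sq_nonneg _), ← ENNReal.ofReal_mul hC, mul_assoc]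
  have hGsum : ∀ y z, Summable fun k => ‖G y z k‖ ^ 2 := fun y z =>
    summable_sq_norm_of_tsum_enorm_sq_ne_top (ne_top_of_le_ne_top ENNReal.ofReal_ne_top (hGle y z))
  -- Riesz–Fischer (restated so that `v` is typed by this file's elaboration of `L²`)
  have hex : ∀ y z : FunctionSpaces.Torus.energySpace d,
      ∃ w : Lp (EuclideanSpace ℝ d) 2 (volume : Measure (UnitAddTorus d)), ∀ k : d → ℤ,
        mFourierCoeff (FunctionSpaces.EuclideanSpace.complexify ∘ (w : UnitAddTorus d → EuclideanSpace ℝ d)) k =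
          G y z k :=
    fun y z => exists_forall_mFourierCoeff_eq_of_isConjSymm (hGsymm y z) (hGsum y z)
  choose v hv using hex
  refine ⟨Real.sqrt C, v, fun y z => ?_, fun y z k => by rw [← hG]; exact hv y z k⟩
  have h1 : ‖v y z‖ₑ ^ 2 ≤ ENNReal.ofReal (C * ‖z‖ ^ 2 * ‖y‖ ^ 2) := by
    rw [enorm_sq_coe_eq_tsum]
    simp only [hv]
    exact hGle y z
  rw [← ofReal_norm, ← ENNReal.ofReal_pow (norm_nonneg _),
    ENNReal.ofReal_le_ofReal_iff (by positivity)] at h1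
  have h2 : ‖v y z‖ ^ 2 ≤ (Real.sqrt C * ‖y‖ * ‖z‖) ^ 2 := by
    rw [mul_pow, mul_pow, Real.sq_sqrt hC]
    linarith
  exact (pow_le_pow_iff_left₀ (norm_nonneg _) (by positivity) two_ne_zero).1 h2

/-! ### The bilinear form -/

/-- **The bounded bilinear form of the mild Navier–Stokes formulation on the energy space of a
three-dimensional torus.**  Let `card d = 3`, `b` a Hilbert basis of `H = Torus.energySpace d` of
Stokes modes (`b i = stokesModeL2 kᵢ aᵢ cᵢ`, `kᵢ ≠ 0`, `0 ≠ aᵢ ⊥ kᵢ`, `m i = 4π²|kᵢ|²`) and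
`S : H →L[ℝ] H` with `S (b i) = (1 + m i)^{-1/2} b i` (the frame operator `(1 + A)^{-1/2}`).  Then
there is a continuous bilinear map `N : H →L[ℝ] H →L[ℝ] H` such that for all `y, z ∈ H`, every index
`i` and every representation `b i = stokesModeL2 k a c`,
`⟪N y z, b i⟫ = -(mᵢ^{-3/4} (1 + mᵢ)^{1/2}) ∫ ⟪(S z)(x), ((S y)·∇)(stokesMode k a c)(x)⟫ dx`
(the `L²` representatives of `S y`, `S z` entering only through their values): `N` is the operator
`(y, z) ↦ A^{-3/4} (1 + A)^{1/2} P B(S y, S z)` of the mild formulation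
`y(t) = e^{-νtA} y₀ + … - ∫₀ᵗ A^{3/4} e^{-ν(t-s)A} N(y(s), y(s)) ds`, bounded by the Fujita–Kato /
Constantin–Foias estimate `‖A^{-1/4} P B(u, w)‖ ≤ C ‖A^{1/2} u‖ ‖A^{1/2} w‖` — here the lattice
product law `H¹ · H¹ ⊂ H^{1/2}` on `ℤ³`.  (Constantin–Foias 1988, Ch. 6, (6.9)–(6.10), (6.19) with
`s₁ = s₂ = 1`, `s₃ = 1/2`; Fujita–Kato 1964, Lemma 1.3–1.4.)
[cite: ConstantinFoiasNSE1988, Ch. 6 (6.9)–(6.10)] -/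
theorem exists_mildBilinearForm (hd : Fintype.card d = 3) (ι : Type*)
    (b : HilbertBasis ι ℝ (FunctionSpaces.Torus.energySpace d)) (m : ι → ℝ)
    (hb : ∀ i, ∃ (k : d → ℤ) (a : EuclideanSpace ℝ d) (c : Bool),
      k ≠ 0 ∧ a ≠ 0 ∧ ⟪FunctionSpaces.Torus.latticeVec k, a⟫_ℝ = 0 ∧
        ((b i : FunctionSpaces.Torus.energySpace d) :
            Lp (EuclideanSpace ℝ d) 2 (volume : Measure (UnitAddTorus d))) = stokesModeL2 k a c ∧
          m i = stokesEigenvalue k)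
    (S : FunctionSpaces.Torus.energySpace d →L[ℝ] FunctionSpaces.Torus.energySpace d)
    (hS : ∀ i, S (b i) = ((1 + m i) ^ (-(1 / 2 : ℝ))) • b i) :
    ∃ Nb : FunctionSpaces.Torus.energySpace d →L[ℝ] FunctionSpaces.Torus.energySpace d →L[ℝ]
        FunctionSpaces.Torus.energySpace d,
      ∀ (y z : FunctionSpaces.Torus.energySpace d) (i : ι) (k : d → ℤ) (a : EuclideanSpace ℝ d) (c : Bool),
        ((b i : FunctionSpaces.Torus.energySpace d) :
            Lp (EuclideanSpace ℝ d) 2 (volume : Measure (UnitAddTorus d))) = stokesModeL2 k a c →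
        ⟪Nb y z, b i⟫_ℝ = -((m i) ^ (-(3 / 4 : ℝ)) * (1 + m i) ^ (1 / 2 : ℝ)) *
          ∫ x, ⟪(((S z : FunctionSpaces.Torus.energySpace d) :
              Lp (EuclideanSpace ℝ d) 2 (volume : Measure (UnitAddTorus d))) : UnitAddTorus d → EuclideanSpace ℝ d) x,
            FunctionSpaces.Torus.convect
              (((S y : FunctionSpaces.Torus.energySpace d) :
                Lp (EuclideanSpace ℝ d) 2 (volume : Measure (UnitAddTorus d))) : UnitAddTorus d → EuclideanSpace ℝ d)
              (stokesMode k a c) x⟫_ℝ := by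
  -- the weaker mode hypothesis consumed by the frame bound and the eigenvalue lemma
  have hb' : ∀ i, ∃ (k : d → ℤ) (a : EuclideanSpace ℝ d) (c : Bool),
      ((b i : FunctionSpaces.Torus.energySpace d) : Lp (EuclideanSpace ℝ d) 2 (volume : Measure (UnitAddTorus d))) = stokesModeL2 k a c ∧ m i = stokesEigenvalue k := fun i => by
    obtain ⟨k, a, c, -, -, -, h1, h2⟩ := hb i
    exact ⟨k, a, c, h1, h2⟩
  obtain ⟨C, v, hvnorm, hv⟩ := exists_coefficientField hd b m hb' S hS
  obtain ⟨hvaddl, hvsmull, hvaddr, hvsmulr⟩ := bilinear_of_mFourierCoeff_eq_stokesWeight_smul S v hv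
  -- the bilinear map `N₀ y z = P v(y, z)`
  obtain ⟨N₀, hN₀⟩ : ∃ N₀ : FunctionSpaces.Torus.energySpace d →ₗ[ℝ] FunctionSpaces.Torus.energySpace d →ₗ[ℝ] FunctionSpaces.Torus.energySpace d,
      ∀ y z, N₀ y z = (FunctionSpaces.Torus.energySpace d).orthogonalProjectionOnto (v y z) :=
    ⟨(LinearMap.mk₂ ℝ v hvaddl hvsmull hvaddr hvsmulr).compr₂
        (FunctionSpaces.Torus.energySpace d).orthogonalProjectionOnto.toLinearMap,
      fun y z => by
        simp only [LinearMap.compr₂_apply, LinearMap.mk₂_apply, ContinuousLinearMap.coe_coe]⟩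
  have hN₀b : ∀ y z, ‖N₀ y z‖ ≤ C * ‖y‖ * ‖z‖ := fun y z => by
    rw [hN₀ y z]
    exact ((FunctionSpaces.Torus.energySpace d).norm_orthogonalProjectionOnto_apply_le (v y z)).trans (hvnorm y z)
  refine ⟨N₀.mkContinuous₂ C hN₀b, fun y z i k a c hik => ?_⟩
  rw [LinearMap.mkContinuous₂_apply, hN₀ y z, Submodule.inner_orthogonalProjectionOnto_eq_of_mem_right]
  have e1 : ⟪v y z, ((b i : FunctionSpaces.Torus.energySpace d) : Lp (EuclideanSpace ℝ d) 2 (volume : Measure (UnitAddTorus d)))⟫_ℝ =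
      (⟪(if c then (1 : ℂ) else -Complex.I) • FunctionSpaces.EuclideanSpace.complexify a,
        mFourierCoeff (FunctionSpaces.EuclideanSpace.complexify ∘
          ((v y z : Lp (EuclideanSpace ℝ d) 2 (volume : Measure (UnitAddTorus d))) : UnitAddTorus d → EuclideanSpace ℝ d)) k⟫_ℂ).re := by
    rw [hik, real_inner_comm, inner_stokesModeL2_coe]
  -- `Re ⟪ζ, G(k)⟫ = -γₖ ∫ ⟪w, (u·∇)φ⟫`
  rw [e1, hv y z k, inner_smul_right, Complex.re_ofReal_mul,
    integral_inner_convect_stokesMode (Lp.memLp _) (Lp.memLp _) k a c,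
    eq_stokesEigenvalue_of_coe_eq_stokesModeL2 b m hb' i hik]

end Torus

end Literature.Analysis.FluidPDE

end
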